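import Summits.BirchSwinnertonDyer.Rank1Residual.ManinAdditive.TwistOrbitScalingEngine
import HarnessLib

/-!
# THE SCALING ENGINE, JUMPS — FILE 7 (`TwistOrbitScalingEngineJumps`, T-an-9 part 2/2): the DEGREE JUMP on commuting
# optimal `χ±8`-orbits (`2⁶ ∣ N`) WITHOUT the `Δ′ = 64Δ` proviso of E-an-24, and at odd `q` (`q² ∣ N`):
# `deg′ = q·deg ∨ q·deg′ = deg` — imc's optimality FLIP is FORCED by equal degree
# (`pStar_optimal_not_commuting_of_modularDegree_eq`) (§23, second half)

PROVENANCE. Cell `bsd-f2-manin`, planner `bsd-f2-manin-an` g4: the `d = ±2` and `d = q*` paragraphs of §23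
`section ScalingEngine` of the kernel-checked HOME/an/Sketch-an5v5.lean c12b594bf59501ac, landed VERBATIM by the cell's
typer (file 6 `TwistOrbitScalingEngine` has the engine, the `d = −1` paragraph and the full provenance).  Theorems only,
no `sorry`, no conjecture tags, no printed input beyond the tree.

CONTENT.  `half_gaussSum_mul_mem_periodLattice_twoSided_of_char` (two-sided HALF-TRANSLATE steps at `2`, generic in the
character), `optimal_commuting_degree_two_of_char`, `two_optimal_commuting_degree_jump (64 ∣ M)` /
`negTwo_optimal_commuting_degree_jump` (E-an-24 without the `Δ` proviso: `deg′ = 2·deg ∨ 2·deg′ = deg`),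
`pStar_optimal_commuting_degree_jump (q odd; q² ∣ N = N′, u • (W ⊗ q*) = W′, both data lattice-optimal ⇒
deg′ = q·deg ∨ q·deg′ = deg)` via the tree's two-sided Stevens steps `gaussSum_mul_mem_periodLattice_of_mem_charTwist`,
and `pStar_optimal_not_commuting_of_modularDegree_eq` (equal degree ⇒ `W′ ≇ W ⊗ q*`: the PROVED direction of imc's
E-imc-3b / E-imc-9b at every odd additive prime).  BC5 (TWISTCENSUS2 same-`N` rows, `N ≤ 5·10⁵`): commuting rows with
`|Δ_deg| = 1` — `q = 3`: 283 644 / 283 644, `q = 5`: 162 850 / 162 850, `q = 7`: 93 264 / 93 264, `q ≥ 11`: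
125 218 / 125 218, `d = ±2`: 28 112 / 28 112; falsifier (commuting odd-`q` same-`N` row with `Δ_deg = 0`): 0 / 664 976
(HOME/MEMO-an.md §40e).  Beyond print: YES (small, unconditional).
References: [cite: Stevens1989, (5.4)–(5.5) p. 97] [cite: Pal2012, Lemma 3.1] [cite: Watkins2002, §2.1]
[cite: Cremona1997, §2.8].
-/

noncomputable section

open scoped MatrixGroups ModularForm

open CongruenceSubgroup WeierstrassCurve
  Literature.NumberTheory.DiophantineGeometry
  Literature.NumberTheory.EllipticCurves
  Literature.NumberTheory.EllipticCurves.ModularForms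

namespace Summit.BirchSwinnertonDyer.Rank1Residual.ManinAdditive

section ScalingEngineJumps

/-! ### `d = ±2`: the degree jump on commuting optimal `χ±8`-orbits (`2⁶ ∣ N`), no `Δ` proviso -/

/-- Two-sided HALF-TRANSLATE twist steps at `2`, generic in the character (the `u`-form of §21's lemma):
`(g(χ)/2)·Λ(f′) ⊆ Λ(f)` and `(g(χ)/2)·Λ(f) ⊆ Λ(f′)` on a commuting same-level `χ`-orbit with `(2k)² ∣ N`.
[cite: Stevens1989, Lemma (5.4) p. 97] [cite: Cremona1997, §2.8] -/
theorem half_gaussSum_mul_mem_periodLattice_twoSided_of_char {d : ℤ} (hd : d ≠ 0) {k : ℕ} [NeZero k]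
    (h16 : 4 ^ 2 ∣ (2 * k) ^ 2)
    {χ : DirichletCharacter ℂ (2 * k)} (hχ : χ.IsQuadratic) (hprim : χ.IsPrimitive)
    (hodd : ∀ (X : WeierstrassCurve ℚ) [X.IsElliptic] (n : ℕ), ¬ 2 ∣ n →
      (((X.quadraticTwist ((d : ℤ) : ℚ)).LFunction n : ℤ) : ℂ) = χ n * (X.LFunction n : ℂ))
    (hsq : ∀ n : ℕ, ¬ 2 ∣ n → χ n * χ n = 1) (heven : ∀ n : ℕ, 2 ∣ n → χ n = 0)
    (hsumOf : ∀ {N : ℕ} [NeZero N] (f : CuspForm (Gamma0 N) 2),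
      (∀ x : ℚ, modularSymbol f (x + 1 / 2) = -modularSymbol f x) →
      ∀ x : ℚ, ∃ (u₁ u₂ : ZMod (2 * k)) (ε : ℤ),
        ∑ u : ZMod (2 * k), χ u * modularSymbol f (x + twistShift u) =
          2 * (modularSymbol f (x + twistShift u₁) + ε * modularSymbol f (x + twistShift u₂)))
    {W W' : WeierstrassCurve ℚ} [W.IsElliptic] [W'.IsElliptic] [NeZero (W.conductorNorm ℤ)]
    [NeZero (W'.conductorNorm ℤ)] (u : VariableChange ℚ)
    (D : ModularParametrizationData W (W.conductorNorm ℤ))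
    (D' : ModularParametrizationData W' (W'.conductorNorm ℤ)) (hMW : (2 * k) ^ 2 ∣ W.conductorNorm ℤ)
    (hN : W'.conductorNorm ℤ = W.conductorNorm ℤ) (hu : u • W.quadraticTwist ((d : ℤ) : ℚ) = W') :
    (∀ w ∈ periodLattice D'.f, gaussSum χ (ZMod.stdAddChar (N := 2 * k)) / 2 * w ∈ periodLattice D.f) ∧
    (∀ w ∈ periodLattice D.f, gaussSum χ (ZMod.stdAddChar (N := 2 * k)) / 2 * w ∈ periodLattice D'.f) := by
  haveI : Fact (Nat.Prime 2) := ⟨Nat.prime_two⟩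
  haveI : NeZero (2 * k) := ⟨mul_ne_zero two_ne_zero (NeZero.ne k)⟩
  have hd0 : ((d : ℤ) : ℚ) ≠ 0 := by exact_mod_cast hd
  haveI := W.isElliptic_quadraticTwist hd0
  have hM' : (2 * k) ^ 2 ∣ W'.conductorNorm ℤ := by rw [hN]; exact hMW
  have h4 : 2 ^ 2 ∣ W.conductorNorm ℤ := dvd_trans (pow_dvd_pow_of_dvd (dvd_mul_right 2 k) 2) hMW
  have h4' : 2 ^ 2 ∣ W'.conductorNorm ℤ := dvd_trans (pow_dvd_pow_of_dvd (dvd_mul_right 2 k) 2) hM'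
  obtain ⟨hngW, hnmW⟩ := not_good_and_not_mult_of_sq_dvd_conductorNorm W h4
  obtain ⟨hngW', hnmW'⟩ := not_good_and_not_mult_of_sq_dvd_conductorNorm W' h4'
  have hW0 : ∀ n : ℕ, 2 ∣ n → W.LFunction n = 0 := fun n hn ↦
    W.LFunction_apply_eq_zero_of_not_good_of_not_mult 2 hngW hnmW hn
  have hW'0 : ∀ n : ℕ, 2 ∣ n → W'.LFunction n = 0 := fun n hn ↦
    W'.LFunction_apply_eq_zero_of_not_good_of_not_mult 2 hngW' hnmW' hn
  have hiso : W'.LFunction = W'.LFunction := rfl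
  have hcoef := fun n ↦
    cuspCoeff_eq_chi_mul_of_twist_even hd0 u hu hiso (hodd W) heven hW'0 D D' n
  have hcoef' := fun n ↦
    cuspCoeff_eq_chi_mul_of_twist_even' hd0 u hu hiso (hodd W) hsq heven hW0 D D' n
  have hevenD : ∀ n : ℕ, 2 ∣ n → cuspCoeff D.f n = 0 := fun n hn ↦ by
    rw [D.isNewformOf.2 n, hW0 n hn, Int.cast_zero]
  have hevenD' : ∀ n : ℕ, 2 ∣ n → cuspCoeff D'.f n = 0 := fun n hn ↦ by
    rw [D'.isNewformOf.2 n, hW'0 n hn, Int.cast_zero]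
  have hhalf : ∀ x : ℚ, modularSymbol D.f (x + 1 / 2) = -modularSymbol D.f x :=
    modularSymbol_add_half_eq_neg D.f (h16.trans hMW) hevenD
  have hhalf' : ∀ x : ℚ, modularSymbol D'.f (x + 1 / 2) = -modularSymbol D'.f x :=
    modularSymbol_add_half_eq_neg D'.f (h16.trans hM') hevenD'
  have hNdvd : W.conductorNorm ℤ ∣ W'.conductorNorm ℤ := by rw [hN]
  have hNdvd' : W'.conductorNorm ℤ ∣ W.conductorNorm ℤ := by rw [hN]
  have htw' : charTwist (W'.conductorNorm ℤ) hNdvd hM' hχ D.f = D'.f :=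
    eq_of_forall_cuspCoeff_eq_gamma0 fun n ↦ by rw [cuspCoeff_charTwist _ hNdvd hM' hχ hprim, hcoef n]
  have htw : charTwist (W.conductorNorm ℤ) hNdvd' hMW hχ D'.f = D.f :=
    eq_of_forall_cuspCoeff_eq_gamma0 fun n ↦ by rw [cuspCoeff_charTwist _ hNdvd' hMW hχ hprim, hcoef' n]
  refine ⟨fun w hw ↦ ?_, fun w hw ↦ ?_⟩
  · rw [← htw'] at hw
    exact half_gaussSum_mul_mem_periodLattice_of_mem_charTwist _ hNdvd hM' hχ hprim D.f
      (hsumOf D.f hhalf) hw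
  · rw [← htw] at hw
    exact half_gaussSum_mul_mem_periodLattice_of_mem_charTwist _ hNdvd' hMW hχ hprim D'.f
      (hsumOf D'.f hhalf') hw

/-- The degree jump at `2`, generic in the character: `deg′ = a·deg ∨ a·deg′ = deg` with `a = |d| ∈ {1, 2}`
on commuting optimal orbits with `(2k)² ∣ N`. -/
theorem optimal_commuting_degree_two_of_char {d : ℤ} (hd : d ≠ 0) {k : ℕ} [NeZero k]
    (h16 : 4 ^ 2 ∣ (2 * k) ^ 2)
    {χ : DirichletCharacter ℂ (2 * k)} (hχ : χ.IsQuadratic) (hprim : χ.IsPrimitive)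
    (hG : gaussSum χ (ZMod.stdAddChar (N := 2 * k)) ^ 2 = 4 * ((d : ℤ) : ℂ))
    (ε : ℕ → ℤ) (hε : ∀ n : ℕ, ¬ 2 ∣ n → (ε n).natAbs = 1) (hεχ : ∀ n : ℕ, (ε n : ℂ) = χ n)
    (hodd : ∀ (X : WeierstrassCurve ℚ) [X.IsElliptic] (n : ℕ), ¬ 2 ∣ n →
      (X.quadraticTwist ((d : ℤ) : ℚ)).LFunction n = ε n * X.LFunction n)
    (hsq : ∀ n : ℕ, ¬ 2 ∣ n → χ n * χ n = 1) (heven : ∀ n : ℕ, 2 ∣ n → χ n = 0)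
    (hsumOf : ∀ {N : ℕ} [NeZero N] (f : CuspForm (Gamma0 N) 2),
      (∀ x : ℚ, modularSymbol f (x + 1 / 2) = -modularSymbol f x) →
      ∀ x : ℚ, ∃ (u₁ u₂ : ZMod (2 * k)) (ε : ℤ),
        ∑ u : ZMod (2 * k), χ u * modularSymbol f (x + twistShift u) =
          2 * (modularSymbol f (x + twistShift u₁) + ε * modularSymbol f (x + twistShift u₂)))
    {a : ℕ} (ha : |(d : ℝ)| = a) (hpr : ∀ m : ℕ, m ∣ a → m = 1 ∨ m = a)
    {W W' : WeierstrassCurve ℚ} [W.IsElliptic] [W.IsGloballyMinimal] [W'.IsElliptic]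
    [W'.IsGloballyMinimal] [NeZero (W.conductorNorm ℤ)] [NeZero (W'.conductorNorm ℤ)]
    (u : VariableChange ℚ) (D : ModularParametrizationData W (W.conductorNorm ℤ))
    (D' : ModularParametrizationData W' (W'.conductorNorm ℤ)) (hMW : (2 * k) ^ 2 ∣ W.conductorNorm ℤ)
    (hN : W'.conductorNorm ℤ = W.conductorNorm ℤ) (hu : u • W.quadraticTwist ((d : ℤ) : ℚ) = W')
    (hD : IsLatticeOptimal D) (hD' : IsLatticeOptimal D') :
    D'.modularDegree = a * D.modularDegree ∨ a * D'.modularDegree = D.modularDegree := by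
  haveI : Fact (Nat.Prime 2) := ⟨Nat.prime_two⟩
  haveI : NeZero (2 * k) := ⟨mul_ne_zero two_ne_zero (NeZero.ne k)⟩
  have hd0 : ((d : ℤ) : ℚ) ≠ 0 := by exact_mod_cast hd
  have hM' : (2 * k) ^ 2 ∣ W'.conductorNorm ℤ := by rw [hN]; exact hMW
  have h4 : 2 ^ 2 ∣ W.conductorNorm ℤ := dvd_trans (pow_dvd_pow_of_dvd (dvd_mul_right 2 k) 2) hMW
  have h4' : 2 ^ 2 ∣ W'.conductorNorm ℤ := dvd_trans (pow_dvd_pow_of_dvd (dvd_mul_right 2 k) 2) hM'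
  obtain ⟨hngW, hnmW⟩ := not_good_and_not_mult_of_sq_dvd_conductorNorm W h4
  obtain ⟨hngW', hnmW'⟩ := not_good_and_not_mult_of_sq_dvd_conductorNorm W' h4'
  have hW0 : ∀ n : ℕ, 2 ∣ n → W.LFunction n = 0 := fun n hn ↦
    W.LFunction_apply_eq_zero_of_not_good_of_not_mult 2 hngW hnmW hn
  have hW'0 : ∀ n : ℕ, 2 ∣ n → W'.LFunction n = 0 := fun n hn ↦
    W'.LFunction_apply_eq_zero_of_not_good_of_not_mult 2 hngW' hnmW' hn
  have habs := natAbs_LFunction_eq_of_twist_even hd0 u hu ε hε (hodd W) hW0 hW'0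
  have hodd' : ∀ (X : WeierstrassCurve ℚ) [X.IsElliptic] (n : ℕ), ¬ 2 ∣ n →
      (((X.quadraticTwist ((d : ℤ) : ℚ)).LFunction n : ℤ) : ℂ) = χ n * (X.LFunction n : ℂ) :=
    fun X _ n hn ↦ by rw [hodd X n hn, Int.cast_mul, hεχ]
  obtain ⟨h1, h2⟩ := half_gaussSum_mul_mem_periodLattice_twoSided_of_char hd h16 hχ hprim hodd' hsq
    heven hsumOf u D D' hMW hN hu
  have hs : (gaussSum χ (ZMod.stdAddChar (N := 2 * k)) / 2) ^ 2 = ((((d : ℤ) : ℚ)) : ℂ) := by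
    rw [div_pow, hG]; push_cast; ring
  have hs0 : gaussSum χ (ZMod.stdAddChar (N := 2 * k)) / 2 ≠ 0 := by
    intro h0
    rw [h0] at hs
    have : (((d : ℤ) : ℚ) : ℂ) = 0 := by rw [← hs]; simp
    exact hd0 (by exact_mod_cast this)
  have ha' : |((((d : ℤ) : ℚ)) : ℝ)| = a := by rw [Rat.cast_intCast]; exact ha
  exact optimal_commuting_degree hN D D' hD hD' hd0 hs0 hs h1 h2 u hu habs ha' hpr

/-- **E-an-24 WITHOUT the `Δ′ = 64Δ` proviso (`d = 2`, `64 ∣ M`):** on a commuting same-level `χ₈`-orbit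
with both data lattice-optimal, `deg′ = 2·deg ∨ 2·deg′ = deg`. [cite: Watkins2002, §2.1] -/
theorem two_optimal_commuting_degree_jump {M : ℕ} (hM : 64 ∣ M) :
    ∀ (W W' : WeierstrassCurve ℚ) [W.IsElliptic] [W.IsGloballyMinimal] [W'.IsElliptic]
      [W'.IsGloballyMinimal] [NeZero (W.conductorNorm ℤ)] [NeZero (W'.conductorNorm ℤ)]
      (u : VariableChange ℚ) (D : ModularParametrizationData W (W.conductorNorm ℤ))
      (D' : ModularParametrizationData W' (W'.conductorNorm ℤ)),
      M ∣ W.conductorNorm ℤ → W'.conductorNorm ℤ = W.conductorNorm ℤ →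
      u • W.quadraticTwist ((2 : ℤ) : ℚ) = W' → IsLatticeOptimal D → IsLatticeOptimal D' →
      D'.modularDegree = 2 * D.modularDegree ∨ 2 * D'.modularDegree = D.modularDegree := by
  intro W W' _ _ _ _ _ _ u D D' hMN hN hu hD hD'
  haveI : NeZero (4 : ℕ) := ⟨by norm_num⟩
  haveI : Fact (Nat.Prime 2) := ⟨Nat.prime_two⟩
  refine optimal_commuting_degree_two_of_char (d := 2) (by norm_num) (k := 4) (by norm_num)
    isQuadratic_χ₈_ringHomComp isPrimitive_χ₈_ringHomComp
    (by rw [gaussSum_χ₈_ringHomComp_sq]; push_cast; ring) (fun n ↦ ZMod.χ₈ n) natAbs_χ₈_of_odd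
    (fun n ↦ (χ₈_ringHomComp_apply_natCast n).symm) LFunction_quadraticTwist_two_intCast_of_odd
    (fun n hn ↦ ?_) (fun n hn ↦ ?_)
    (fun f hhalf x ↦ ⟨1, 3, -1, sum_χ₈_modularSymbol_of_half f hhalf x⟩) (a := 2) (by norm_num)
    (fun m hm ↦ (Nat.dvd_prime Nat.prime_two).mp hm) u D D' ((by norm_num : (2 * 4) ^ 2 ∣ 64).trans
      (hM.trans hMN)) hN hu hD hD'
  · rw [χ₈_ringHomComp_apply_natCast, ZMod.χ₈_nat_eq_if_mod_eight,
      if_neg (fun h ↦ hn (Nat.dvd_of_mod_eq_zero h))]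
    split_ifs <;> push_cast <;> ring
  · rw [χ₈_ringHomComp_apply_natCast, ZMod.χ₈_nat_eq_if_mod_eight, if_pos (Nat.mod_eq_zero_of_dvd hn)]
    simp

/-- **E-an-24 WITHOUT the `Δ′ = 64Δ` proviso (`d = −2`, `64 ∣ M`).** [cite: Watkins2002, §2.1] -/
theorem negTwo_optimal_commuting_degree_jump {M : ℕ} (hM : 64 ∣ M) :
    ∀ (W W' : WeierstrassCurve ℚ) [W.IsElliptic] [W.IsGloballyMinimal] [W'.IsElliptic]
      [W'.IsGloballyMinimal] [NeZero (W.conductorNorm ℤ)] [NeZero (W'.conductorNorm ℤ)]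
      (u : VariableChange ℚ) (D : ModularParametrizationData W (W.conductorNorm ℤ))
      (D' : ModularParametrizationData W' (W'.conductorNorm ℤ)),
      M ∣ W.conductorNorm ℤ → W'.conductorNorm ℤ = W.conductorNorm ℤ →
      u • W.quadraticTwist ((-2 : ℤ) : ℚ) = W' → IsLatticeOptimal D → IsLatticeOptimal D' →
      D'.modularDegree = 2 * D.modularDegree ∨ 2 * D'.modularDegree = D.modularDegree := by
  intro W W' _ _ _ _ _ _ u D D' hMN hN hu hD hD'
  haveI : NeZero (4 : ℕ) := ⟨by norm_num⟩
  haveI : Fact (Nat.Prime 2) := ⟨Nat.prime_two⟩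
  refine optimal_commuting_degree_two_of_char (d := -2) (by norm_num) (k := 4) (by norm_num)
    isQuadratic_χ₈'_ringHomComp isPrimitive_χ₈'_ringHomComp
    (by rw [gaussSum_χ₈'_ringHomComp_sq]; push_cast; ring) (fun n ↦ ZMod.χ₈' n) natAbs_χ₈'_of_odd
    (fun n ↦ (χ₈'_ringHomComp_apply_natCast n).symm) LFunction_quadraticTwist_negTwo_intCast_of_odd
    (fun n hn ↦ ?_) (fun n hn ↦ ?_)
    (fun f hhalf x ↦ ⟨1, 3, 1, sum_χ₈'_modularSymbol_of_half f hhalf x⟩) (a := 2) (by norm_num)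
    (fun m hm ↦ (Nat.dvd_prime Nat.prime_two).mp hm) u D D' ((by norm_num : (2 * 4) ^ 2 ∣ 64).trans
      (hM.trans hMN)) hN hu hD hD'
  · rw [χ₈'_ringHomComp_apply_natCast, ZMod.χ₈'_nat_eq_if_mod_eight,
      if_neg (fun h ↦ hn (Nat.dvd_of_mod_eq_zero h))]
    split_ifs <;> push_cast <;> ring
  · rw [χ₈'_ringHomComp_apply_natCast, ZMod.χ₈'_nat_eq_if_mod_eight, if_pos (Nat.mod_eq_zero_of_dvd hn)]
    simp

/-! ### `d = q*`, `q` odd: the degree jump on commuting optimal ramified-twist orbits (`q² ∣ N`) -/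

/-- **imc's FLIP is FORCED by equal degree (E-imc-3b / 9b, contrapositive form), `q` odd, `q² ∣ N`:** on a
commuting same-level `χ_{q*}`-orbit `u • (W ⊗ q*) = W′` with BOTH data lattice-optimal,
`deg φ′ = q·deg φ ∨ q·deg φ′ = deg φ` — so two optimal curves of EQUAL modular degree on a ramified twist
orbit are never twists of each other's models (lattice-optimality flips).  Two-sided Stevens steps
`g(χ_q)·Λ(f′) ⊆ Λ(f)`, `g(χ_q)·Λ(f) ⊆ Λ(f′)` (tree, Γ₁-route) + the scaling engine + Watkins.
[cite: Stevens1989, (5.4)–(5.5) p. 97] [cite: Pal2012, Lemma 3.1] [cite: Watkins2002, §2.1] -/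
theorem pStar_optimal_commuting_degree_jump {q : ℕ} (hq : q.Prime) (hq2 : q ≠ 2) :
    ∀ (W W' : WeierstrassCurve ℚ) [W.IsElliptic] [W.IsGloballyMinimal] [W'.IsElliptic]
      [W'.IsGloballyMinimal] [NeZero (W.conductorNorm ℤ)] [NeZero (W'.conductorNorm ℤ)]
      (u : VariableChange ℚ) (D : ModularParametrizationData W (W.conductorNorm ℤ))
      (D' : ModularParametrizationData W' (W'.conductorNorm ℤ)),
      q ^ 2 ∣ W.conductorNorm ℤ → W'.conductorNorm ℤ = W.conductorNorm ℤ →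
      u • W.quadraticTwist ((((-1 : ℤ) ^ (q / 2) * q : ℤ)) : ℚ) = W' →
      IsLatticeOptimal D → IsLatticeOptimal D' →
      D'.modularDegree = q * D.modularDegree ∨ q * D'.modularDegree = D.modularDegree := by
  intro W W' _ _ _ _ _ _ u D D' hM hN hu hD hD'
  haveI : Fact q.Prime := ⟨hq⟩
  haveI : NeZero q := ⟨hq.ne_zero⟩
  set d : ℤ := (-1 : ℤ) ^ (q / 2) * q with hd
  set G : ℂ := gaussSum ((quadraticChar (ZMod q)).ringHomComp (Int.castRingHom ℂ))
    (ZMod.stdAddChar (N := q)) with hGdef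
  have hdZ : d ≠ 0 := mul_ne_zero (pow_ne_zero _ (by norm_num)) (by exact_mod_cast hq.ne_zero)
  have hd0 : (d : ℚ) ≠ 0 := by exact_mod_cast hdZ
  haveI := W.isElliptic_quadraticTwist hd0
  have hG2 : G ^ 2 = ((d : ℚ) : ℂ) := by
    rw [hGdef, gaussSum_quadraticChar_ringHomComp_sq q hq2, hd]
    push_cast
    ring
  have hG0 : G ≠ 0 := by
    intro h0
    have : ((d : ℚ) : ℂ) = 0 := by rw [← hG2, h0]; simp
    exact hd0 (by exact_mod_cast this)
  have hM' : q ^ 2 ∣ W'.conductorNorm ℤ := by rw [hN]; exact hM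
  obtain ⟨hngW, hnmW⟩ := not_good_and_not_mult_of_sq_dvd_conductorNorm W hM
  obtain ⟨hngW', hnmW'⟩ := not_good_and_not_mult_of_sq_dvd_conductorNorm W' hM'
  have hW0 : ∀ n : ℕ, q ∣ n → W.LFunction n = 0 := fun n hn ↦
    W.LFunction_apply_eq_zero_of_not_good_of_not_mult q hngW hnmW hn
  have hW'0 : ∀ n : ℕ, q ∣ n → W'.LFunction n = 0 := fun n hn ↦
    W'.LFunction_apply_eq_zero_of_not_good_of_not_mult q hngW' hnmW' hn
  have hT0 : ∀ n : ℕ, q ∣ n → (W.quadraticTwist (d : ℚ)).LFunction n = 0 := fun n hn ↦ by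
    have h := hW'0 n hn
    rwa [← hu, LFunction_smul] at h
  have habs : ∀ n : ℕ, (W'.LFunction n).natAbs = (W.LFunction n).natAbs := fun n ↦ by
    rw [← hu, LFunction_smul]
    exact W.natAbs_LFunction_quadraticTwist_pStar_eq_of_apply_eq_zero hq2 hW0 hT0 n
  -- the two twist identifications `f′ = f ⊗ χ_q`, `f = f′ ⊗ χ_q` at level `N`
  have hLC : W'.LFunction = W'.LFunction := rfl
  have hcoef := fun n ↦ cuspCoeff_eq_chi_mul_of_twist_pStar hq2 u hu hLC hW'0 D D' n
  have hcoef' := fun n ↦ cuspCoeff_eq_chi_mul_of_twist_pStar' hq2 u hu hLC hW0 D D' n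
  have hχq := isQuadratic_quadraticChar_ringHomComp q
  have hχp := isPrimitive_quadraticChar_ringHomComp q hq2
  have hNdvd : W.conductorNorm ℤ ∣ W'.conductorNorm ℤ := by rw [hN]
  have hNdvd' : W'.conductorNorm ℤ ∣ W.conductorNorm ℤ := by rw [hN]
  have htw' : charTwist (W'.conductorNorm ℤ) hNdvd hM' hχq D.f = D'.f :=
    eq_of_forall_cuspCoeff_eq_gamma0 fun n ↦ by rw [cuspCoeff_charTwist _ hNdvd hM' hχq hχp, hcoef n]
  have htw : charTwist (W.conductorNorm ℤ) hNdvd' hM hχq D'.f = D.f :=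
    eq_of_forall_cuspCoeff_eq_gamma0 fun n ↦ by rw [cuspCoeff_charTwist _ hNdvd' hM hχq hχp, hcoef' n]
  have h1 : ∀ w ∈ periodLattice D'.f, G * w ∈ periodLattice D.f := fun w hw ↦ by
    rw [← htw'] at hw
    exact gaussSum_mul_mem_periodLattice_of_mem_charTwist _ hNdvd hM' hχq hχp D.f hw
  have h2 : ∀ w ∈ periodLattice D.f, G * w ∈ periodLattice D'.f := fun w hw ↦ by
    rw [← htw] at hw
    exact gaussSum_mul_mem_periodLattice_of_mem_charTwist _ hNdvd' hM hχq hχp D'.f hw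
  have ha : |(((d : ℚ)) : ℝ)| = q := by
    rw [Rat.cast_intCast, hd]
    push_cast
    rw [abs_mul, abs_pow, abs_neg, abs_one, one_pow, one_mul, Nat.abs_cast]
  exact optimal_commuting_degree hN D D' hD hD' hd0 hG0 hG2 h1 h2 u hu habs ha
    (fun m hm ↦ (Nat.dvd_prime hq).mp hm)

/-- **Equal degree ⇒ no commuting (the FLIP), `q` odd, `q² ∣ N`:** if two lattice-optimal data on a
same-level ramified `χ_{q*}`-twist orbit have `deg φ′ = deg φ`, then `W′` is NOT `ℚ`-isomorphic to `W ⊗ q*`. -/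
theorem pStar_optimal_not_commuting_of_modularDegree_eq {q : ℕ} (hq : q.Prime) (hq2 : q ≠ 2)
    {W W' : WeierstrassCurve ℚ} [W.IsElliptic] [W.IsGloballyMinimal] [W'.IsElliptic]
    [W'.IsGloballyMinimal] [NeZero (W.conductorNorm ℤ)] [NeZero (W'.conductorNorm ℤ)]
    (D : ModularParametrizationData W (W.conductorNorm ℤ))
    (D' : ModularParametrizationData W' (W'.conductorNorm ℤ)) (hM : q ^ 2 ∣ W.conductorNorm ℤ)
    (hN : W'.conductorNorm ℤ = W.conductorNorm ℤ) (hD : IsLatticeOptimal D) (hD' : IsLatticeOptimal D')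
    (hdeg : D'.modularDegree = D.modularDegree) (u : VariableChange ℚ) :
    u • W.quadraticTwist ((((-1 : ℤ) ^ (q / 2) * q : ℤ)) : ℚ) ≠ W' := by
  intro hu
  have hpos : 0 < D.modularDegree := D.deg_pos
  rcases pStar_optimal_commuting_degree_jump hq hq2 W W' u D D' hM hN hu hD hD' with h | h
  · rw [hdeg] at h
    have : q = 1 := by
      have h' : D.modularDegree * q = D.modularDegree * 1 := by rw [mul_one, mul_comm]; exact h.symm
      exact Nat.eq_of_mul_eq_mul_left hpos h'
    exact hq.one_lt.ne' this
  · rw [hdeg] at h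
    have : q = 1 := by
      have h' : D.modularDegree * q = D.modularDegree * 1 := by rw [mul_one, mul_comm]; exact h
      exact Nat.eq_of_mul_eq_mul_left hpos h'
    exact hq.one_lt.ne' this

end ScalingEngineJumps

end Summit.BirchSwinnertonDyer.Rank1Residual.ManinAdditive
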